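import Summits.Ventures.PercRepro.RankLevelSetLevelSixHeavyCellSq27DI2U
import Summits.Ventures.PercRepro.RankLevelSetCoreSixColoopFreeFlatCap
import Summits.Ventures.PercRepro.RankLevelSetLevelSixCapGlue25
import Summits.Ventures.PercRepro.TriangleCapEightI
import Summits.Ventures.PercRepro.S1TrianglePlusSharp
import Summits.Ventures.PercRepro.S1SeriesLever14
import Summits.Ventures.PercRepro.RankLevelSetLevelSixArithHeavySq24DF8A

/-!
# PercRepro — THE 24 ROW, THE COLOOP-FREE CELL `(p ≥ 24, 8)` WITH THE FULL COLOOP-FREE KIT (p8 g10, S3)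

`proofs/SUBCLAIM-S3-p8.md` §3x. On a coloop-free core the heavy classes are empty at `ν₁ = 8 = d` (the coloop-free flat cap), `s₄ ≤ gb14 8 32 = 62` (p2's series lever), and the 6- and 7-circuit counts take the coloop-free step (`s₆ ≤ 1137`, `s₇ ≤ 2196`): the cell `sq27di2u` with `uG = uH = 0`, the caps `s₃ ≤ 12`, `s₅ ≤ 426` at `n₀ = 32` and the parts ArithHeavySq24DF8A (`Kn = 146838`): ratio `0.991` (checks/cf_small2_24.out). Axioms: standard.
-/

open scoped Matroid

namespace PercRepro

namespace ThmN

open Set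

variable {α : Type}

/-- **The COLOOP-FREE `e`-free core at level `6`, corank `8`, rank `p ≥ 24`** — the heavy classes empty, `gb14`, the 6- and 7-circuit steps. -/
theorem c025_core_six_basis_sq24_free8 (M : Matroid α) [M.Finite] (p : ℕ) (hp : 24 ≤ p) (hcf : ∀ e ∈ M.E, ¬ M.IsColoop e)
    (hR : M.eRank = (p : ℕ∞)) (hn : M.E.ncard = p + 8)
    (hfree : ∀ e ∈ M.E, ∃ A ⊆ M.E \ {e}, e ∉ M.closure A ∧ e ∉ M.closure ((M.E \ {e}) \ A)) :
    RLS M p 6 := by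
  classical
  have hd : M.E.encard = M.eRank + (8 : ℕ) := by
    rw [hR, ← M.ground_finite.cast_ncard_eq, hn]
    push_cast
    ring
  have hL : ∀ e ∈ M.E, ¬ M.IsLoop e := not_isLoop_of_free M hfree
  have hs : ∀ e ∈ M.E, ∀ f ∈ M.E, e ≠ f → M.eRk {e, f} = 2 := by
    intro e he f hf hef
    have h2 : (2 : ℕ∞) ≤ M.eRk {e, f} :=
      two_le_eRk_of_two_le_ncard_of_free M hfree (pair_subset he hf) (by rw [ncard_pair hef])
    have h3 : M.eRk {e, f} ≤ 2 := by
      have := M.eRk_le_encard {e, f}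
      rwa [encard_pair hef] at this
    exact le_antisymm h3 h2
  have hC1 : ∀ L ⊆ M.E, M.eRk L = 2 → L.ncard ≤ 3 :=
    fun L hL hr => ncard_le_three_of_eRk_two M hs hfree hL hr
  have hC2 : ∀ P ⊆ M.E, M.eRk P ≤ 3 → P.ncard ≤ 6 :=
    fun P hP hr => ncard_le_six_of_eRk_le_three_of_free M hfree hP hr
  have hflat6 : ∀ X ⊆ M.E, M.eRk X ≤ ((6 : ℕ) : ℕ∞) → X.ncard ≤ 13 :=
    fun X hX hr => ncard_le_five_add_of_coloopFree M hcf hR hn (by omega) hX (by exact_mod_cast hr)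
  have hflat5 : ∀ X ⊆ M.E, M.eRk X ≤ ((6 - 1 : ℕ) : ℕ∞) → X.ncard ≤ 12 :=
    fun X hX hr => ncard_le_four_add_of_coloopFree M hcf hR hn (by omega) hX hr
  have hUG : (Matroid.UG M 6 8).ncard ≤ 0 := by
    rw [UG_eq_empty_of_cap M hflat6 (by norm_num)]; simp
  have hUH : (Matroid.UH M 6 8).ncard ≤ 0 := by
    rw [Matroid.UH_eq_empty (M := M) (q := 6) (ν₁ := 8) hflat5 (by norm_num)]; simp
  have hΦ : phiK p 6 ≤ (2 : ℚ) ^ (p + 6) / (((p + 6).choose 6 : ℕ) : ℚ) := phiK_le_two_pow_div_six p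
  rw [RLS_iff]
  exact c025_core_six_heavy_cell_sq27di2u M p 8 8 0 0 0 146838 1000 14 426 62 12 1137 2196
      ((p + 6).choose 6) (Nat.choose_pos (by omega)) (phiK p 6) hΦ (by norm_num) (by omega)
      (by norm_num) hUG hUH (Or.inl (by norm_num)) (by norm_num) (by norm_num) (by norm_num)
      (s3_cf_of M hfree hcf (d := 7) (by simpa using hd) 32 12 (by norm_num) (by omega) (by norm_num [TriangleCap.cq3]) (by norm_num [TriangleCap.cq3]) (by norm_num [TriangleCap.cq3]))
      ((S1.ncard_fourCircuits_le_gb14 8 M hfree hd 32 (by rw [coloops_eq_empty_of_forall M hcf, Set.sdiff_empty, hn]; omega)).trans (by decide))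
      (s5_cf_of M hfree hcf (d := 7) (by rw [hd]; norm_num) 32 360 426 (by norm_num) (by omega) (by decide) (by omega))
      (s6_cf_of M hfree hcf (d := 7) (by rw [hd]; norm_num) 32 924 1137 (by norm_num) (by omega) (by decide) (by omega))
      (s7_cf_of M hfree hcf (d := 7) (by rw [hd]; norm_num) 32 1716 2196 (by norm_num) (by omega) (by decide) (by omega))
      (Or.inl (tail_six_heavy_sq24DF8_8 p hp)) hR hn hfree (level_six_poly_heavy_sq24DF8_8 p hp)

end ThmN

end PercRepro
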